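/-
COR-CM (cell pub-hodgecm2, stage 2 of the Hodge ladder) — count-neutral kernel combinatorics (seat prover-pub-hodgecm2-b23-g40-0, binder
prover b23, gen 40; claim COMPLEMENT-FACES F10, HOME/INBOX.md l.9766/l.9940; sequel of `Census/ComplementFacesBlockCount.lean` and
`Census/ComplementFacesGenerate.lean`).  Theorems only (kernel numerals for three named complements), in seat b09's intrinsic model; Mathlib's
`DihedralGroup` / `QuaternionGroup` order formulas; `decide` only on closed numerals of a six/eight-element table; no certificate, no named fact,
no geometry, no `sorry`.  `Interfaces.lean` (C1), every E term, B01 and `Transposition/*` are untouched.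
HONEST FRAMING: `HC_CM` is NOT proved, here or anywhere in the tree; nothing here is a period or a headline.
-/
import Summits.HodgeConjecture.CorCM.Census.ComplementFacesBlockCount
import Summits.HodgeConjecture.CorCM.Census.ComplementFacesGenerate
import Mathlib.GroupTheory.SpecificGroups.Dihedral
import Mathlib.GroupTheory.SpecificGroups.Quaternion

/-!
# Faces of a complemented Galois CM type, VIII: kernel numerals — complements `S₃ ≅ D₃`, `D₄`, `Q₈`: `β = 10, 27, 21`, `μ = 8, 25, 19`

Part VI (`card_block_mul_card_of_cpl`: `β·|G| = Σ_{a ∈ A} (1 + [2 ∣ ord a])·2^{n / ord a}`) read through an isomorphism of the complement `A`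
with a named group (`card_block_mul_card_of_cpl_equiv`), and the order statistics of Mathlib's `DihedralGroup 3` (`≅ S₃`), `DihedralGroup 4`,
`QuaternionGroup 2` (`= Q₈`):
* `A ≅ D₃`: `1·2⁶ + 2·2² + 3·2·2³ = 120 = 10·12` ⟹ **`β = 10`** (`card_block_of_cpl_dihedral_three`), and by part V (`n = 6` even, `δ = 1`) the least
  number of face relations generating `hodgeSpan` modulo pairs is **`8`** (`isLeast_card_gfaces_generate_of_cpl_dihedral_three`) — the Galois CM
  fields with group `D₆ = S₃ × C₂` (closures of the sextic CM fields `k·F₀`, `F₀` a non-Galois real cubic), matching the census certificate of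
  `Census/DuodecicFaceTransportDihedral*.lean` (8 faces, kit job j137010) now as a census-free minimality theorem;
* `A ≅ D₄`: `2⁸ + 2·2⁴ + 2·2·2² + 4·2·2⁴ = 432 = 27·16` ⟹ **`β = 27`, `μ = 25`**;
* `A ≅ Q₈`: `2⁸ + 2·2⁴ + 6·2·2² = 336 = 21·16` ⟹ **`β = 21`, `μ = 19`**
(seat b09 gen 31 / lit-andre-3's censused rows `S₃ × ℤ/2: 10/8`, `D₄ × ℤ/2: 27/25`, `Q₈ × ℤ/2: 21/19`).  All [folklore] bookkeeping over
[Milne1999, Prop. 2.1].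

## References
* [Milne1999] J. S. Milne, Lefschetz motives and the Tate conjecture, Compositio Math. 117 (1999), Prop. 2.1, p. 54.
* [Pohlmann1968] H. Pohlmann, Algebraic cycles on abelian varieties of complex multiplication type, Ann. of Math. 88 (1968), Thm 1.
-/

namespace Summit.HodgeConjecture.CorCM.Census.ComplementFaces

open Finset
open Summit.HodgeConjecture.CorCM.Prior.AllgGroup.RfwfAllgGroup
open Summit.HodgeConjecture.CorCM.Census.BlockParity
open Summit.HodgeConjecture.CorCM.Census.Coinvariant

noncomputable section

variable {G : Type*} [Group G] [Fintype G] [DecidableEq G] (c : G)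
variable {A : Subgroup G} (hA : ∀ x : G, x ∈ A ↔ c * x ∉ A)

include hA

/-! ## §1 Transport of the block count along an isomorphism of the complement -/

/-- **The block count through a named complement**: for `e : A ≃* A₀`,
`β(G, c)·|G| = Σ_{a : A₀} (1 + [2 ∣ ord a])·2^{(|G|/2) / ord a}`. [folklore] -/
theorem card_block_mul_card_of_cpl_equiv (hc2 : c * c = 1) (hcen : ∀ x : G, x * c = c * x) {A₀ : Type*} [Group A₀] [Fintype A₀]
    (e : A ≃* A₀) :
    Fintype.card (Block c) * Fintype.card G =
      ∑ a : A₀, (if Even (orderOf a) then 2 else 1) * 2 ^ (Fintype.card G / 2 / orderOf a) := by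
  classical
  rw [card_block_mul_card_of_cpl c hA hc2 hcen,
    Finset.sum_subtype (p := fun x : G => x ∈ A) (cplT c A hA).1 (fun x => mem_cplT c hA x)]
  refine Fintype.sum_equiv e.toEquiv _ _ fun a => ?_
  rw [MulEquiv.toEquiv_eq_coe, MulEquiv.coe_toEquiv, MulEquiv.orderOf_eq, Subgroup.orderOf_coe]

/-- `|G| = 2·|A₀|` for a complement `A ≃* A₀`. [folklore] -/
theorem card_eq_two_mul_of_cpl_equiv (hc2 : c * c = 1) {A₀ : Type*} [Group A₀] [Fintype A₀] (e : A ≃* A₀) :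
    Fintype.card G = 2 * Fintype.card A₀ := by
  have h1 := natCard_cpl c hc2 hA
  rw [Nat.card_congr e.toEquiv, Nat.card_eq_fintype_card] at h1
  have h2 := two_mul_card_val c hc2 (cplT c A hA)
  rw [card_cplT c hc2 hA] at h2
  omega

/-! ## §2 Order statistics of `D₃`, `D₄`, `Q₈` -/

omit hA in
omit [Group G] [Fintype G] [DecidableEq G] in
/-- Order statistics of `D₃ ≅ S₃`: `Σ (1 + [2 ∣ ord])·2^{6/ord} = 120`. [folklore] -/
theorem sum_dihedral_three : ∑ a : DihedralGroup 3, (if Even (orderOf a) then 2 else 1) * 2 ^ (6 / orderOf a) = 120 := by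
  have h : ∀ a : DihedralGroup 3, (if Even (orderOf a) then 2 else 1) * 2 ^ (6 / orderOf a) =
      (match a with | .r i => if i = 0 then 64 else 4 | .sr _ => 16) := by
    rintro (i | i)
    · rw [DihedralGroup.orderOf_r]
      fin_cases i <;> decide
    · show _ = 16
      rw [DihedralGroup.orderOf_sr]
      decide
  rw [Fintype.sum_congr _ _ h]
  decide

omit hA in
omit [Group G] [Fintype G] [DecidableEq G] in
/-- Order statistics of `D₄`: `Σ (1 + [2 ∣ ord])·2^{8/ord} = 432`. [folklore] -/
theorem sum_dihedral_four : ∑ a : DihedralGroup 4, (if Even (orderOf a) then 2 else 1) * 2 ^ (8 / orderOf a) = 432 := by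
  have h : ∀ a : DihedralGroup 4, (if Even (orderOf a) then 2 else 1) * 2 ^ (8 / orderOf a) =
      (match a with | .r i => if i = 0 then 256 else if i = 2 then 32 else 8 | .sr _ => 32) := by
    rintro (i | i)
    · rw [DihedralGroup.orderOf_r]
      fin_cases i <;> decide
    · show _ = 32
      rw [DihedralGroup.orderOf_sr]
      decide
  rw [Fintype.sum_congr _ _ h]
  decide

omit hA in
omit [Group G] [Fintype G] [DecidableEq G] in
/-- Order statistics of `Q₈`: `Σ (1 + [2 ∣ ord])·2^{8/ord} = 336`. [folklore] -/
theorem sum_quaternion_two : ∑ a : QuaternionGroup 2, (if Even (orderOf a) then 2 else 1) * 2 ^ (8 / orderOf a) = 336 := by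
  have h : ∀ a : QuaternionGroup 2, (if Even (orderOf a) then 2 else 1) * 2 ^ (8 / orderOf a) =
      (match a with | .a i => if i = 0 then 256 else if i = 2 then 32 else 8 | .xa _ => 8) := by
    rintro (i | i)
    · rw [QuaternionGroup.orderOf_a]
      fin_cases i <;> decide
    · show _ = 8
      rw [QuaternionGroup.orderOf_xa]
      decide
  rw [Fintype.sum_congr _ _ h]
  decide

/-! ## §3 The block counts and the minimal face numbers -/

/-- **Complement `≅ D₃ ≅ S₃` (`G ≅ S₃ × C₂ = D₆`): `β = 10`.** [folklore] -/
theorem card_block_of_cpl_dihedral_three (hc2 : c * c = 1) (hcen : ∀ x : G, x * c = c * x) (e : A ≃* DihedralGroup 3) :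
    Fintype.card (Block c) = 10 := by
  have hG : Fintype.card G = 12 := by rw [card_eq_two_mul_of_cpl_equiv c hA hc2 e, DihedralGroup.card]
  have h := card_block_mul_card_of_cpl_equiv c hA hc2 hcen e
  rw [hG, show (12 / 2 : ℕ) = 6 from rfl, sum_dihedral_three] at h
  omega

/-- **Complement `≅ D₄` (`G ≅ D₄ × C₂`): `β = 27`.** [folklore] -/
theorem card_block_of_cpl_dihedral_four (hc2 : c * c = 1) (hcen : ∀ x : G, x * c = c * x) (e : A ≃* DihedralGroup 4) :
    Fintype.card (Block c) = 27 := by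
  have hG : Fintype.card G = 16 := by rw [card_eq_two_mul_of_cpl_equiv c hA hc2 e, DihedralGroup.card]
  have h := card_block_mul_card_of_cpl_equiv c hA hc2 hcen e
  rw [hG, show (16 / 2 : ℕ) = 8 from rfl, sum_dihedral_four] at h
  omega

/-- **Complement `≅ Q₈` (`G ≅ Q₈ × C₂`): `β = 21`.** [folklore] -/
theorem card_block_of_cpl_quaternion (hc2 : c * c = 1) (hcen : ∀ x : G, x * c = c * x) (e : A ≃* QuaternionGroup 2) :
    Fintype.card (Block c) = 21 := by
  have hG : Fintype.card G = 16 := by rw [card_eq_two_mul_of_cpl_equiv c hA hc2 e, QuaternionGroup.card]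
  have h := card_block_mul_card_of_cpl_equiv c hA hc2 hcen e
  rw [hG, show (16 / 2 : ℕ) = 8 from rfl, sum_quaternion_two] at h
  omega

/-- The least face number from `β` and an even complement: `β − 2`. [folklore] -/
theorem isLeast_card_gfaces_generate_of_cpl_of_card (hc2 : c * c = 1) (hc1 : c ≠ 1) (hcen : ∀ x : G, x * c = c * x)
    (heven : Even (Fintype.card G / 2)) {β : ℕ} (hβ : Fintype.card (Block c) = β) :
    IsLeast {m : ℕ | ∃ S : Finset (CMF G c →₀ ℤ), (↑S ⊆ gfaceSet G c hc2) ∧ S.card = m ∧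
      hodgeSpan c hc2 ≤ Submodule.span ℤ (pairSet c) ⊔ Submodule.span ℤ (translates c S)} (β - 2) := by
  have h := isLeast_card_gfaces_generate_fibreTwo_of_cpl c hA hc2 hc1 hcen
  have h2 := fibreTwo_add_two_eq_card_block_of_cpl c hc2 hc1 hcen hA heven
  rwa [show fibreTwo c hc2 = β - 2 by omega] at h

/-- **Complement `≅ S₃` (the `D₆` Galois CM types): EXACTLY `8` face relations generate the Hodge lattice modulo pairs, none fewer.**
[folklore] -/
theorem isLeast_card_gfaces_generate_of_cpl_dihedral_three (hc2 : c * c = 1) (hc1 : c ≠ 1) (hcen : ∀ x : G, x * c = c * x)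
    (e : A ≃* DihedralGroup 3) :
    IsLeast {m : ℕ | ∃ S : Finset (CMF G c →₀ ℤ), (↑S ⊆ gfaceSet G c hc2) ∧ S.card = m ∧
      hodgeSpan c hc2 ≤ Submodule.span ℤ (pairSet c) ⊔ Submodule.span ℤ (translates c S)} 8 :=
  isLeast_card_gfaces_generate_of_cpl_of_card c hA hc2 hc1 hcen
    (by rw [card_eq_two_mul_of_cpl_equiv c hA hc2 e, DihedralGroup.card]; decide) (card_block_of_cpl_dihedral_three c hA hc2 hcen e)

/-- **Complement `≅ D₄`: EXACTLY `25` face relations, none fewer.** [folklore] -/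
theorem isLeast_card_gfaces_generate_of_cpl_dihedral_four (hc2 : c * c = 1) (hc1 : c ≠ 1) (hcen : ∀ x : G, x * c = c * x)
    (e : A ≃* DihedralGroup 4) :
    IsLeast {m : ℕ | ∃ S : Finset (CMF G c →₀ ℤ), (↑S ⊆ gfaceSet G c hc2) ∧ S.card = m ∧
      hodgeSpan c hc2 ≤ Submodule.span ℤ (pairSet c) ⊔ Submodule.span ℤ (translates c S)} 25 :=
  isLeast_card_gfaces_generate_of_cpl_of_card c hA hc2 hc1 hcen
    (by rw [card_eq_two_mul_of_cpl_equiv c hA hc2 e, DihedralGroup.card]; decide) (card_block_of_cpl_dihedral_four c hA hc2 hcen e)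

/-- **Complement `≅ Q₈`: EXACTLY `19` face relations, none fewer.** [folklore] -/
theorem isLeast_card_gfaces_generate_of_cpl_quaternion (hc2 : c * c = 1) (hc1 : c ≠ 1) (hcen : ∀ x : G, x * c = c * x)
    (e : A ≃* QuaternionGroup 2) :
    IsLeast {m : ℕ | ∃ S : Finset (CMF G c →₀ ℤ), (↑S ⊆ gfaceSet G c hc2) ∧ S.card = m ∧
      hodgeSpan c hc2 ≤ Submodule.span ℤ (pairSet c) ⊔ Submodule.span ℤ (translates c S)} 19 :=
  isLeast_card_gfaces_generate_of_cpl_of_card c hA hc2 hc1 hcen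
    (by rw [card_eq_two_mul_of_cpl_equiv c hA hc2 e, QuaternionGroup.card]; decide) (card_block_of_cpl_quaternion c hA hc2 hcen e)

end

end Summit.HodgeConjecture.CorCM.Census.ComplementFaces
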